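import Summits.QuantumFields.YangMills.Theorems.BalabanUVNodesN15FullPropagatorMatrixByPartsNode
import Summits.QuantumFields.YangMills.Theorems.BalabanUVNodesN15BackgroundByPartsPrimitive
import HarnessLib

/-!
# `NE2PlusOperator` BY NAME FOR BAŁABAN's FULL `U ≡ 1` PROPAGATOR ⊗ 1_𝔤 OVER THE PRIMITIVE MATRIX CARRIER: ENTRYWISE sup letters on the matrix coefficient fields, their
# first and their second difference quotients — every two-grid fit clause DERIVED, no rate exponent among the data (dag-n15-c g9, FILE 17; Track-A node N15 = NE2, s1
# «background-layer OPERATOR ingredient»)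

`--kind proof --supports stmt-QuantumFields-20544 --as helper` (K3⁷; count-neutral).  Imports BY NAME this seat's FILE 16 `…N15FullPropagatorMatrixByPartsNode`
(`fgInstanceM`, `fgFamilyM`, ★★★ `ne2PlusOperator_fullGM_byParts`; through it FILE 13 `coeffBgMBP` ∕ `bgPairingMBP` ∕ `bgOpsMBP`, FILE 12 `fgradMat_apply`, M2 `avgM₁` ∕
`avgM₁_zero`) and g8 FILE 11 `…N15BackgroundByPartsPrimitive` (`coeffBgC2`, `fgInstanceC2`, ★ `reg_slim_of_C2`; through it FILE 9 `reg_BP_of_slim` ∕ `inv_pow_le_rate`, FILE 7a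
`coeffBgBP`, W1 `kingPrV_sub`); nothing in the tree is modified.

WHAT.  The matrix twin of FILES 9∕11 in ONE step, ENTRYWISE.  §1 `entryCfg U i j` (the `(i, j)` entry of a matrix coefficient family as a scalar family), `avgM₁_fst_entry` ∕
`avgM₁_snd_entry` (the entrywise block average IS the block average of the entry), ★ `reg_MBP_of_entrywise` (FILE 13's nine entrywise clauses of `coeffBgMBP` at level `c` FROM
FILE 7a's `coeffBgBP` at level `c` on every entry).  §2 the PRIMITIVE MATRIX CARRIER `coeffBgMC2 J ι τ′ n′ M`: a matrix coefficient family `U = (C′, A′_μ)` on ONE lattice is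
regular at level `c` iff ENTRYWISE `|C′_{ij}|, |A′_{μ,ij}| ≤ cMα₀`, `|∇′_κC′_{ij}|, |∇′_κA′_{μ,ij}| ≤ cMα₀`, `|∇′_κ∇′_μA′_{μ,ij}| ≤ cMα₀` (FILE 11's `coeffBgC2` on every
entry; NO block map, NO coarse partner, NO rate number); pairing ∕ instance ∕ kernel family over it (FILE 13's entry operators `bgOpsMBP`), the torus instance `fgInstanceMC2 d ι hL i` ∕
`fgFamilyMC2 d ι hL b i` at `G = gOp ⊗ 1_ι` — NO rate exponent among the data; `entry_reg_C2_of_MC2`.  §3 ★ `reg_MBP_of_MC2` (torus: primitive-matrix-regular at level `c` ⟹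
`coeffBgMBP`-regular at level `2(2d+3)c` for ANY rate exponent `γ ≤ 1`: FILE 11 `reg_slim_of_C2` then FILE 9 `reg_BP_of_slim` on every entry, then §1), ★★ transfer
`ne2PlusOperator_fullGM_C2_of_MBP`, ★★★ **`ne2PlusOperator_fullGM_C2`**: `NE2PlusOperator c₃₅ (fgInstanceMC2 d ι hL) (fgFamilyMC2 d ι hL b)` — `d ≥ 1`, odd `L ≥ 3`,
`b > 0`, `c₃₅ > 0`, `ι` nonempty — HYPOTHESIS-FREE, the rate exponent PRODUCED (`1∕(8(d+1))` inside the `∃`); `_dim4`.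

HONEST FRAMING.  Operator layer of the node for the GENUINE `U ≡ 1` propagator `gOp ⊗ 1_𝔤` and a LIVE matrix-coefficient first-order background whose regularity hypotheses
are exactly ENTRYWISE sup letters on `U`, `∇′U`, `∇′∇′U` — the SHAPE of (3.35)–(3.36) p.396 for `𝔤`-valued (here: `End(𝔤)`-valued, in coordinates) coefficient fields
(crudely: one uniform constant `cMα₀`).  MODEL-LEVEL still: the coefficient matrices are FREE data (Bałaban's (3.52) has `C = ad`-polynomials `Phi1(η, ad A)` of ONE gauge
field `A` and both bond orientations — the sequel's), entrywise-linearised (C3) transport.  NE2⁺ as printed NOT PRINTED, NOT proved, not claimed; count-neutral (typed 28∕28 ·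
discharged 5∕27 of record unchanged); N15 NOT discharged; one finite T⁴ at fixed ε — NOT ℝ⁴, NOT infinite volume, NOT OS, NOT a mass gap, NOT Clay.
-/

noncomputable section

open scoped BigOperators
open Finset

namespace Summit.QuantumFields.YangMills.BalabanUVNodes.N15.BackgroundLayer

open Literature.MathematicalPhysics.QuantumFieldTheory.Balaban1983to89
open Literature.MathematicalPhysics.QuantumFieldTheory.Balaban1983to89.T4EtaRate (PairedInstance EtaPairing EtaRateIneq342 NE2PlusOperator)
open Literature.MathematicalPhysics.QuantumFieldTheory.Balaban1983to89.T4EtaRateCoeffDefect (pull FibreOsc blockAvg)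
open Literature.MathematicalPhysics.QuantumFieldTheory.Balaban1983to89.B5Prop11Plancherel (Tor fine unitVec)
open Literature.MathematicalPhysics.QuantumFieldTheory.Balaban1983to89.B5SiteBridgeP12 (MP)
open Literature.MathematicalPhysics.QuantumFieldTheory.Balaban1983to89.B6UnitTorusCarrier (unitTorusGeo)
open Summit.QuantumFields.YangMills.BalabanUVNodes.N15.OperatorReadout (opGeo opFamily)
open Summit.QuantumFields.YangMills.BalabanUVNodes.N15.MatrixSpecies (liftMap liftBlk liftEquiv)
open Summit.QuantumFields.YangMills.BalabanUVNodes.N15.TwoGrid (gOp symbOp sLap TGIndex TGIndex.Mn)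
open Summit.QuantumFields.YangMills.BalabanUVNodes.N15.VectorPiece (blkFine kingPrV kingPrV_sub bshiftEquiv tensorId)

variable {d : ℕ}

/-! ## §1 Entrywise reduction: a matrix coefficient family is `coeffBgMBP`-regular as soon as every entry is `coeffBgBP`-regular -/

section Entrywise

variable {X X' : Type} (J ι : Type) [Fintype X'] [DecidableEq X]

/-- THE `(i, j)` ENTRY of a matrix coefficient family `U = (C′, A′_μ)`, as a scalar first-order coefficient family `(C′_{ij}, A′_{μ,ij})`. [folklore] -/
def entryCfg (U : (X' → Matrix ι ι ℝ) × (J → X' → Matrix ι ι ℝ)) (i j : ι) : (X' → ℝ) × (J → X' → ℝ) := (fun x' => U.1 x' i j, fun μ x' => U.2 μ x' i j)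

variable {J ι}

/-- the entrywise block average of `C′` IS the block average of the entry. [folklore] -/
theorem avgM₁_fst_entry (π : X' → X) (U : (X' → Matrix ι ι ℝ) × (J → X' → Matrix ι ι ℝ)) (i j : ι) :
    (fun x => (avgM₁ J ι π U).1 x i j) = blockAvg π (entryCfg J ι U i j).1 := rfl

/-- the entrywise block average of `A′_μ` IS the block average of the entry. [folklore] -/
theorem avgM₁_snd_entry (π : X' → X) (U : (X' → Matrix ι ι ℝ) × (J → X' → Matrix ι ι ℝ)) (μ : J) (i j : ι) :
    (fun x => (avgM₁ J ι π U).2 μ x i j) = blockAvg π ((entryCfg J ι U i j).2 μ) := rfl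

/-- ★ **ENTRYWISE REDUCTION**: if every entry `(C′_{ij}, A′_{μ,ij})` of a matrix coefficient family is `coeffBgBP`-regular at level `c` (FILE 7a's nine scalar clauses), the family is
`coeffBgMBP`-regular at level `c` (FILE 13's nine entrywise clauses) — the entrywise quotients `fgradMat` and block averages `avgM₁` are the quotients and averages of the entries.
[folklore] -/
theorem reg_MBP_of_entrywise {π : X' → X} {τ : J → X ≃ X} {τ' : J → X' ≃ X'} {n n' M θ c α₀ : ℝ} {U : (X' → Matrix ι ι ℝ) × (J → X' → Matrix ι ι ℝ)}
    (h : ∀ i j, (coeffBgBP J π τ τ' n n' M θ).Reg335 c α₀ (entryCfg J ι U i j)) : (coeffBgMBP J ι π τ τ' n n' M θ).Reg335 c α₀ U := by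
  refine ⟨⟨⟨fun x' i j => (h i j).1.1.1 x', fun μ x' i j => (h i j).1.1.2 μ x'⟩, fun i j => (h i j).1.2.1, fun μ i j => (h i j).1.2.2 μ⟩,
    fun μ x i j => ?_, fun μ x' i j => ?_, fun μ x' i j => (h i j).2.2.2.1 μ x', fun μ x' i j => ?_, fun μ x i j => (h i j).2.2.2.2.2 μ x⟩
  · rw [fgradMat_apply, avgM₁_snd_entry]; exact (h i j).2.1 μ x
  · rw [fgradMat_apply]; exact (h i j).2.2.1 μ x'
  · rw [fgradMat_apply, fgradMat_apply, avgM₁_snd_entry]; exact (h i j).2.2.2.2.1 μ x'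

end Entrywise

/-! ## §2 The primitive matrix carrier, its pairing, instance, kernel family and torus instance -/

section Carrier

variable {X X' : Type} (J ι : Type) [Fintype ι] [Fintype X'] [DecidableEq X]

/-- THE PRIMITIVE (3.35)–(3.36)-SHAPED MATRIX CARRIER of a matrix coefficient family `U = (C′, A′_μ)` on one lattice with bond shifts `τ′_κ` and quotient parameter `n′`:
level-`c` regularity = ENTRYWISE `|C′_{ij}|, |A′_{μ,ij}| ≤ cMα₀`, `|∇′_κC′_{ij}|, |∇′_κA′_{μ,ij}| ≤ cMα₀` (field and first quotients, all directions) and `|∇′_κ∇′_μA′_{μ,ij}| ≤ cMα₀`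
(second quotients) — FILE 11's `coeffBgC2` on every entry; no complexification clauses. [cite: Balaban1985BackgroundPropagators, (3.35)–(3.36) p.396 (shape); (3.52) p.400 (matrix-valued coefficients: shape)] -/
def coeffBgMC2 (τ' : J → X' ≃ X') (n' M : ℝ) : B9.Backgrounds where
  Cfg := (X' → Matrix ι ι ℝ) × (J → X' → Matrix ι ι ℝ)
  one := 0
  mul := fun U₁ U₂ => U₁ + U₂
  Reg335 := fun c α₀ U =>
    ((∀ x' i j, |U.1 x' i j| ≤ c * M * α₀) ∧ ∀ μ x' i j, |U.2 μ x' i j| ≤ c * M * α₀) ∧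
      ((∀ κ x' i j, |fgrad n' (τ' κ) (fun y => U.1 y i j) x'| ≤ c * M * α₀) ∧ ∀ μ κ x' i j, |fgrad n' (τ' κ) (fun y => U.2 μ y i j) x'| ≤ c * M * α₀) ∧
        ∀ μ κ x' i j, |fgrad n' (τ' κ) (fgrad n' (τ' μ) (fun y => U.2 μ y i j)) x'| ≤ c * M * α₀
  Reg336 := fun c α₀ U => ∀ μ κ x' i j, |fgrad n' (τ' κ) (fgrad n' (τ' μ) (fun y => U.2 μ y i j)) x'| ≤ c * M * α₀
  Cplx337 := fun _ _ _ => True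
  Cplx338 := fun _ _ _ => True

variable {J ι} in
omit [Fintype ι] [Fintype X'] [DecidableEq X] in
/-- primitive-matrix-regular at level `c` IS primitive-regular at level `c` on every entry (FILE 11's `coeffBgC2`). [folklore] -/
theorem entry_reg_C2_of_MC2 {τ' : J → X' ≃ X'} {n' M c α₀ : ℝ} {U : (X' → Matrix ι ι ℝ) × (J → X' → Matrix ι ι ℝ)}
    (h : (coeffBgMC2 J ι τ' n' M).Reg335 c α₀ U) (i j : ι) : (coeffBgC2 J τ' n' M).Reg335 c α₀ (entryCfg J ι U i j) :=
  ⟨⟨fun x' => h.1.1 x' i j, fun μ x' => h.1.2 μ x' i j⟩, ⟨fun κ x' => h.2.1.1 κ x' i j, fun μ κ x' => h.2.1.2 μ κ x' i j⟩, fun μ κ x' => h.2.2 μ κ x' i j⟩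

variable {g : B6.Geometry} [Fintype X]

/-- THE η-PAIRING over the primitive matrix carriers (fine: `coeffBgMC2` at `n′`; coarse: at `n` on the coarse lattice) — NOT PRINTED data, as FILE 13's `bgPairingMBP`: pull-back
along `liftMap π ι`, entrywise block-averaged families. [cite: King1986, p.664 (convention before Prop. 3.8)] -/
def bgPairingMC2 (blk : X → g.Site) (π : X' → X) (τ : J → X ≃ X) (τ' : J → X' ≃ X') (n n' : ℝ) (m : ℕ) (hL : g.L ≠ 0) :
    EtaPairing (opGeo g (X × ι) (liftBlk blk ι)) (fineGeo g (X' × ι) (liftBlk (blk ∘ π) ι) m) (coeffBgMC2 J ι τ n g.M) (coeffBgMC2 J ι τ' n' g.M) where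
  n := m
  k_eq := rfl
  L_eq := rfl
  M_eq := rfl
  eta_eq := (bgPairingMBP J ι blk π τ τ' n n' m hL 0 0).eta_eq
  ι := fun y => y
  scale_ι := fun _ => rfl
  dist_ι := fun _ _ => rfl
  τ := fun lam => pull (liftMap π ι) lam
  suppIn_τ := fun _ _ h p hp => h (liftMap π ι p) hp
  supNorm_τ := (bgPairingMBP J ι blk π τ τ' n n' m hL 0 0).supNorm_τ
  avg := avgM₁ J ι π
  avg_one := avgM₁_zero J ι π

/-- THE REALISED PAIRED INSTANCE of the matrix by-parts layer over the PRIMITIVE matrix carriers. [cite: Balaban1985BackgroundPropagators, Thm 3.14 pp.426–427 (typing template)] -/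
def bgInstanceMC2 (blk : X → g.Site) (π : X' → X) (τ : J → X ≃ X) (τ' : J → X' ≃ X') (n n' : ℝ) (m : ℕ) (hL : g.L ≠ 0) : PairedInstance :=
  ⟨opGeo g (X × ι) (liftBlk blk ι), fineGeo g (X' × ι) (liftBlk (blk ∘ π) ι) m, coeffBgMC2 J ι τ n g.M, coeffBgMC2 J ι τ' n' g.M,
    bgPairingMC2 J ι blk π τ τ' n n' m hL⟩

/-- THE GUARD IS LIVE: the fine geometry's size parameter is the datum's `M`. [folklore] -/
theorem bgInstanceMC2_M (blk : X → g.Site) (π : X' → X) (τ : J → X ≃ X) (τ' : J → X' ≃ X') (n n' : ℝ) (m : ℕ) (hL : g.L ≠ 0) :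
    (bgInstanceMC2 J ι blk π τ τ' n n' m hL).gf.M = g.M := rfl

end Carrier

section Ops

variable {X X' J ι : Type} [Fintype X] [Fintype X'] [Fintype J] [Fintype ι] [DecidableEq X] [DecidableEq X'] [DecidableEq J] [DecidableEq ι] {g : B6.Geometry}
  (blk : X → g.Site) (π : X' → X)

/-- THE KERNEL FAMILY over the primitive matrix carrier: FILE 13's four entry operators `bgOpsMBP` (entry 2 by parts) read through the block norms of the product carriers.
[cite: Balaban1985BackgroundPropagators, (3.42) p.397 (shape)] -/
def bgFamilyMC2 (τ : J → X ≃ X) (τ' : J → X' ≃ X') (n n' : ℝ) (m : ℕ) (hL : g.L ≠ 0) (ν : J) (G D₃ : (X × ι → ℝ) →ₗ[ℝ] (X × ι → ℝ))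
    (D : J → (X × ι → ℝ) →ₗ[ℝ] (X × ι → ℝ)) (G' D₃' : (X' × ι → ℝ) →ₗ[ℝ] (X' × ι → ℝ)) (D' : J → (X' × ι → ℝ) →ₗ[ℝ] (X' × ι → ℝ)) :
    B9.KernelFamily (bgInstanceMC2 J ι blk π τ τ' n n' m hL).gc (bgInstanceMC2 J ι blk π τ τ' n n' m hL).Bf :=
  show B9.KernelFamily (opGeo g (X × ι) (liftBlk blk ι)) (coeffBgMC2 J ι τ' n' g.M) from
    opFamily (g := g) (B := coeffBgMC2 J ι τ' n' g.M) (liftBlk blk ι) (liftBlk (blk ∘ π) ι) (bgOpsMBP π τ τ' n n' ν G D₃ D G' D₃' D')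

/-- THE RATE INEQUALITY IS THE SAME PREDICATE over the primitive matrix carrier and FILE 13's `coeffBgMBP` (same geometry, same entry operators). [folklore] -/
theorem etaRateIneq342_MC2_iff (τ : J → X ≃ X) (τ' : J → X' ≃ X') (n n' : ℝ) (m : ℕ) (hL : g.L ≠ 0) (θc θ : ℝ) (ν : J)
    (G D₃ : (X × ι → ℝ) →ₗ[ℝ] (X × ι → ℝ)) (D : J → (X × ι → ℝ) →ₗ[ℝ] (X × ι → ℝ)) (G' D₃' : (X' × ι → ℝ) →ₗ[ℝ] (X' × ι → ℝ))
    (D' : J → (X' × ι → ℝ) →ₗ[ℝ] (X' × ι → ℝ)) (B₀ δ₀ γ : ℝ) (U : (X' → Matrix ι ι ℝ) × (J → X' → Matrix ι ι ℝ)) :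
    EtaRateIneq342 (bgFamilyMC2 blk π τ τ' n n' m hL ν G D₃ D G' D₃' D') B₀ δ₀ γ U ↔
      EtaRateIneq342 (bgFamilyMBP blk π τ τ' n n' m hL θc θ ν G D₃ D G' D₃' D') B₀ δ₀ γ U :=
  Iff.rfl

end Ops

section Torus

variable {L : ℕ} [NeZero L]

variable (d) (ι : Type) [Fintype ι] [DecidableEq ι]

/-- THE REALISED PAIRED INSTANCE at an index `(i, ν)` of the torus family of record over the PRIMITIVE matrix carriers (King's pairing, bond shifts at spacings `L^{−k}` ∕ `L^{−m−k}`,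
quotient parameters `L^k` ∕ `L^mL^k`), arguments = `𝔤 ≅ ℝ^ι`-valued 1-forms; NO rate number. [cite: Balaban1985BackgroundPropagators, Thm 3.14 pp.426–427 (typing template)] -/
def fgInstanceMC2 (hL : Odd L ∧ 1 < L) (i : TGIndex × Fin (d + 1)) : PairedInstance :=
  bgInstanceMC2 (Fin (d + 1)) ι (g := unitTorusGeo L i.1.k (TGIndex.Mn d hL i.1)) (blkFine L i.1.k (TGIndex.Mn d hL i.1)) (kingPrV L i.1.k i.1.m (TGIndex.Mn d hL i.1))
    (fun μ => bshiftEquiv (TGIndex.Mn d hL i.1) (L ^ i.1.k) μ) (fun μ => bshiftEquiv (TGIndex.Mn d hL i.1) (L ^ i.1.m * L ^ i.1.k) μ) ((L ^ i.1.k : ℕ) : ℝ)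
    ((L ^ i.1.m * L ^ i.1.k : ℕ) : ℝ) i.1.m (Nat.cast_ne_zero.mpr (NeZero.ne L))

/-- THE REALISED MATRIX BY-PARTS KERNEL FAMILY at `(i, ν)` over the primitive matrix carrier (FILE 16's operators: `G = gOp ⊗ 1_ι`, `D_μ = (∇_μG) ⊗ 1_ι`, `D₃ = (ΔG) ⊗ 1_ι`
at both spacings). [cite: Balaban1985BackgroundPropagators, (3.42) p.397 (shape); Balaban1984PropagatorsII, (2.156) p.250] -/
def fgFamilyMC2 (hL : Odd L ∧ 1 < L) (b : ℝ) (i : TGIndex × Fin (d + 1)) : B9.KernelFamily (fgInstanceMC2 d ι hL i).gc (fgInstanceMC2 d ι hL i).Bf :=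
  bgFamilyMC2 (J := Fin (d + 1)) (ι := ι) (g := unitTorusGeo L i.1.k (TGIndex.Mn d hL i.1)) (blkFine L i.1.k (TGIndex.Mn d hL i.1))
    (kingPrV L i.1.k i.1.m (TGIndex.Mn d hL i.1)) (fun μ => bshiftEquiv (TGIndex.Mn d hL i.1) (L ^ i.1.k) μ)
    (fun μ => bshiftEquiv (TGIndex.Mn d hL i.1) (L ^ i.1.m * L ^ i.1.k) μ) ((L ^ i.1.k : ℕ) : ℝ) ((L ^ i.1.m * L ^ i.1.k : ℕ) : ℝ) i.1.m (Nat.cast_ne_zero.mpr (NeZero.ne L)) i.2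
    (tensorId ι (gOp (TGIndex.Mn d hL i.1) (L ^ i.1.k) b))
    (tensorId ι (symbOp (TGIndex.Mn d hL i.1) (L ^ i.1.k) (sLap (TGIndex.Mn d hL i.1) (L ^ i.1.k) ((L ^ i.1.k : ℕ) : ℝ)) ∘ₗ gOp (TGIndex.Mn d hL i.1) (L ^ i.1.k) b))
    (fun μ => tensorId ι (fgD d (TGIndex.Mn d hL i.1) (L ^ i.1.k) b μ))
    (tensorId ι (gOp (TGIndex.Mn d hL i.1) (L ^ i.1.m * L ^ i.1.k) b))
    (tensorId ι (symbOp (TGIndex.Mn d hL i.1) (L ^ i.1.m * L ^ i.1.k) (sLap (TGIndex.Mn d hL i.1) (L ^ i.1.m * L ^ i.1.k) ((L ^ i.1.m * L ^ i.1.k : ℕ) : ℝ)) ∘ₗ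
      gOp (TGIndex.Mn d hL i.1) (L ^ i.1.m * L ^ i.1.k) b))
    (fun μ => tensorId ι (fgD d (TGIndex.Mn d hL i.1) (L ^ i.1.m * L ^ i.1.k) b μ))

end Torus

/-! ## §3 Primitive-matrix ⟹ `coeffBgMBP` on the torus; the transfer; ★★★ the node theorem over the primitive matrix carrier -/

section Transfer

variable {L : ℕ} [NeZero L] (ι : Type) [Fintype ι] [DecidableEq ι]

omit [DecidableEq ι] in
/-- ★ **PRIMITIVE-MATRIX ⟹ `coeffBgMBP` AT LEVEL `2(2d+3)c`** on the torus family of record, for ANY rate exponent `γ ≤ 1` (`θ = (L^k)^{−γ} ≥ L^{−k}`): every entrywise two-grid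
clause of FILE 13's carrier — block oscillations, coarse gradients of the block means, translated fit, derivative fit, coarse one-step oscillation — is a CONSEQUENCE of the primitive
entrywise letters (FILE 11 `reg_slim_of_C2` and FILE 9 `reg_BP_of_slim` on every entry, FILE 10's lattice Taylor kit inside; §1 `reg_MBP_of_entrywise`). [folklore] -/
theorem reg_MBP_of_MC2 (hL : Odd L ∧ 1 < L) {γ : ℝ} (hγ1 : γ ≤ 1) {c α₀ : ℝ} (i : TGIndex × Fin (d + 1))
    (hc : 0 ≤ c * (unitTorusGeo L i.1.k (TGIndex.Mn d hL i.1)).M * α₀) (U : (fgInstanceMC2 d ι hL i).Bf.Cfg) (hU : (fgInstanceMC2 d ι hL i).Bf.Reg335 c α₀ U) :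
    (fgInstanceM d ι hL γ i).Bf.Reg335 (2 * ((2 * (d : ℝ) + 3) * c)) α₀ U := by
  have hL1 : (1 : ℝ) ≤ (L : ℝ) := by exact_mod_cast hL.2.le
  have hn : (0 : ℝ) < ((L ^ i.1.k : ℕ) : ℝ) := by exact_mod_cast pow_pos (show 0 < L by have := hL.2; omega) _
  have hd0 : (0 : ℝ) ≤ d := Nat.cast_nonneg d
  have hc' : 0 ≤ (2 * (d : ℝ) + 3) * c * (unitTorusGeo L i.1.k (TGIndex.Mn d hL i.1)).M * α₀ := by
    have : (2 * (d : ℝ) + 3) * c * (unitTorusGeo L i.1.k (TGIndex.Mn d hL i.1)).M * α₀ = (2 * (d : ℝ) + 3) * (c * (unitTorusGeo L i.1.k (TGIndex.Mn d hL i.1)).M * α₀) := by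
      ring
    rw [this]; positivity
  exact reg_MBP_of_entrywise fun a e =>
    reg_BP_of_slim hn (inv_pow_le_rate hL1 hγ1) hc' (fun μ x' => kingPrV_sub (TGIndex.Mn d hL i.1) L i.1.k i.1.m x' μ)
      (reg_slim_of_C2 hL hγ1 i hc (entryCfg (Fin (d + 1)) ι U a e) (entry_reg_C2_of_MC2 hU a e))

variable (d)

/-- ★★ **TRANSFER**: `NE2PlusOperator (2(2d+3)c₃₅)` for FILE 16's family over `coeffBgMBP` (rate exponent `γ ≤ 1`) gives `NE2PlusOperator c₃₅` over the PRIMITIVE matrix carrier —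
same predicate (`etaRateIneq342_MC2_iff`), larger admitted class (`reg_MBP_of_MC2`). [cite: Balaban1985BackgroundPropagators, Thm 3.1 p.397 (quantifier template)] -/
theorem ne2PlusOperator_fullGM_C2_of_MBP (hL : Odd L ∧ 1 < L) {b γ : ℝ} (hγ1 : γ ≤ 1) {c35 : ℝ} (hc35 : 0 ≤ c35)
    (h : NE2PlusOperator (2 * ((2 * (d : ℝ) + 3) * c35)) (fgInstanceM d ι hL γ) (fgFamilyM d ι hL b γ)) :
    NE2PlusOperator c35 (fgInstanceMC2 d ι hL) (fgFamilyMC2 d ι hL b) := by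
  obtain ⟨M₅, δ₀, a₀, B₀, γ', hM₅, hδ₀, ha₀, hB₀, hγ', H⟩ := h
  refine ⟨M₅, δ₀, a₀, B₀, γ', hM₅, hδ₀, ha₀, hB₀, hγ', fun i hM α₀ hα₀ hMa U hU => ?_⟩
  have hMpos : 0 < (fgInstanceMC2 d ι hL i).gf.M := hM₅.trans_le hM
  have hc : 0 ≤ c35 * (unitTorusGeo L i.1.k (TGIndex.Mn d hL i.1)).M * α₀ := mul_nonneg (mul_nonneg hc35 hMpos.le) hα₀.le
  exact H i hM α₀ hα₀ hMa U (reg_MBP_of_MC2 ι hL hγ1 i hc U hU)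

variable [Nonempty ι]

/-- ★★★ **`T4EtaRate.NE2PlusOperator` BY NAME, NO DISPLAYED BINDER, over the PRIMITIVE MATRIX (3.35)–(3.36) carrier**: Bałaban's FULL `U ≡ 1` Landau-gauge propagator acting
componentwise on `𝔤 ≅ ℝ^ι`-valued 1-forms (`gOp ⊗ 1_𝔤`, [B6] (2.156)) on the torus family of record, dressed by a LIVE non-abelian first-order background `M_C + Σ_μ M_{A_μ}∇_μ`
(fibrewise-matrix coefficient fields: Bałaban's (3.52) `V′₁(A)` in coordinates, forward orientation) whose regularity is ONLY the entrywise sup letters `|U|, |∇′U|, |∇′∇′U| ≤ c₃₅Mα₀`;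
all four (3.42) entries constructed, entry 2 by parts, `d ≥ 1`, odd `L ≥ 3`, `b > 0`, `c₃₅ > 0`, `ι` nonempty; the rate exponent (`1∕(8(d+1))`) is PRODUCED inside the `∃`.  FILE 16
★★★ at `2(2d+3)c₃₅` through the transfer.  MODEL-LEVEL species (free matrix coefficients, entrywise-linearised transport), GENUINE propagator; NO (3.44) mixed letter.
[cite: Balaban1985BackgroundPropagators, Thm 3.1 p.397 (quantifier template); (3.35)–(3.36) p.396, (3.42) p.397, (3.52) p.400 (shapes); Balaban1984PropagatorsII, (2.156) p.250] -/
theorem ne2PlusOperator_fullGM_C2 (hd1 : 1 ≤ d) (hLodd : Odd L) (hL2 : 2 ≤ L) (hL : Odd L ∧ 1 < L) {b : ℝ} (hb : 0 < b) (c35 : ℝ) (hc35 : 0 < c35) :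
    NE2PlusOperator c35 (fgInstanceMC2 d ι hL) (fgFamilyMC2 d ι hL b) := by
  have hd0 : (0 : ℝ) ≤ d := Nat.cast_nonneg d
  have hγ1 : 1 / (8 * ((d : ℝ) + 1)) ≤ 1 := by
    rw [div_le_one (by positivity)]
    linarith
  exact ne2PlusOperator_fullGM_C2_of_MBP d ι hL hγ1 hc35.le
    (ne2PlusOperator_fullGM_byParts d ι hd1 hLodd hL2 hL hb (2 * ((2 * (d : ℝ) + 3) * c35)) (by positivity))

/-- The four-dimensional instance (`d + 1 = 4`; e.g. `ι = Fin 3` for `𝔤 = su(2)`, `ι = Fin 8` for `su(3)`). [cite: Balaban1985BackgroundPropagators, Thm 3.1 p.397 (quantifier template)] -/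
theorem ne2PlusOperator_fullGM_C2_dim4 (hLodd : Odd L) (hL2 : 2 ≤ L) (hL : Odd L ∧ 1 < L) {b : ℝ} (hb : 0 < b) (c35 : ℝ) (hc35 : 0 < c35) :
    NE2PlusOperator c35 (fgInstanceMC2 3 ι hL) (fgFamilyMC2 3 ι hL b) :=
  ne2PlusOperator_fullGM_C2 3 ι (by norm_num) hLodd hL2 hL hb c35 hc35

end Transfer

end Summit.QuantumFields.YangMills.BalabanUVNodes.N15.BackgroundLayer

end
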